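/-
Copyright (c) 2026 the pub-hodgecm-mathlib formalisation cell (harness21).  Prover seat hodgecm-mathlib-LH4-p07 (g9), req620 Track A «(D-RAM) FOUR-FRAME» squad
(STAGE-1b, row-(2) lineage; dealer LH4-plan (g13) WORD #94 (1) ∕ #97: the RamM lane of the level law — (R4) law arithmetic), 2026-09-04.
-/
import Mathlib.Tactic
import HarnessLib

/-!
# Crux `H413`, line LH4 «(D-RAM) FOUR-FRAME» — STAGE-1b, row (2): (LAW-exponents-RamM) «THE (ks, T) RULE OF THE LEVEL LAW ON TYPE RamM, AS ℕ IDENTITIES» — organ (R4)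

Cell `hodgecm-mathlib` (D-0151), FLOOR 0, crux item H413 = `stmt-HodgeConjecture-24833`, route of record `HCCMUnconditional`; squad F0∕P3c∕LH4; lane
`--supports stmt-HodgeConjecture-24833 --as helper` (count-neutral; pays NO tier-0 row).  THEOREMS ONLY; pure `ℕ` bookkeeping (parity witnesses + `omega`).
OWNER'S ORGAN №17 = (R4) of `SCOPE-RamM-lane.v1` (`F0/P3c/LH4/LH4-p07/g9/…`, 48fdfff2): the RamM law arithmetic is ★ p859957 `law_arith` UNCHANGED (the ℚ-identity is lane-free)
+ these exponent side-goals in ★ `toricCensusSum_ramM[_flip]_cut`'s letters `(g, s0)`, `g + s0 = d` — the (ks, bs) letters of LAW-INSTANCES v1 are the SAME on RamM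
(LAW-FIT over the closed forms: 19 593 cases, 0 bad; as LH4-p08 found on type U).  Consumer: the RamM level socket `levelsCensusC` (SIG 7d4a4a70) right before `law_arith`.
HONEST LABEL.  Count-neutral arithmetic; `HC_CM` is proved only modulo the 7 printed citations (2 remaining named inputs: hLiu418 = `stmt-HodgeConjecture-24832`,
h413 = `stmt-HodgeConjecture-24833`) until rung 0 closes.

## References
* [Rogawski1990] J. D. Rogawski, *Automorphic Representations of Unitary Groups in Three Variables*, Ann. of Math. Stud. 123 (1990): §4.9 Prop. 4.9.1 (b) p. 55.
-/

set_option autoImplicit false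

namespace Summit.HodgeConjecture.HodgeConjecture.Cruxes.H413.F0P3cDyRamLevelsLawExponentsRamM
set_option maxHeartbeats 1600000 in
-- budget only: thirty-two `omega` calls over parity witnesses (no search).
/-- **THE LAW'S EXPONENT BOOKKEEPING ON TYPE RamM, STANDARD LANE (`a` even).**  Twin of ★ p860331 `exponents_std` in the RamM letters `(g, s0)` with `g + s0 = d`
(★ `exists_uniformiser_frame_ramM`'s dictionary): parities `jλ ≡ g`, `m ≡ d`; Eisenstein level `(jλ − g)∕2 = n`; the SAME general rule `hks`∕`hT` as RamK ⊢ the four exponent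
identities ★ p859957 `law_arith` consumes at ★ `toricCensusSum_ramM_cut`'s shapes `(A, B, J, U) := ((jλ−a−g)∕2 + 1, g + s0 − (g+s0)%2, (jλ−a+s0)∕2, (2(m−a)+1−(g+s0))∕2)`.
(LAW-FIT RamM: the closed-form identity `(q−1)q^{ks}W = 2q^m(q^{(jλ−g)∕2+1} − q^{S+bs})` checked for every `g + s0 = d ≤ 7`, five rows, 19 593 cases, 0 bad.)
[cite: Rogawski1990, §4.9 Prop. 4.9.1 (b) p. 55] -/
theorem exponents_std_ramM {a b d g s0 ks T m jl n C : ℕ} (hgs : g + s0 = d) (hjlpar : jl % 2 = g % 2) (hmpar : m % 2 = d % 2) (hmjl : m ≤ jl)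
    (hab1 : d + 2 * a ≤ b + 1) (hbm : b ≤ m) (hg : 1 ≤ g) (hs0 : 1 ≤ s0) (hC : C = m + jl - b) (hn : (jl - g) / 2 + 1 = n + 1) (ha2 : a % 2 = 0)
    (hks : 2 * ks + 2 * ((d + a % 2) / 2) = a + a % 2 + (b + b % 2)) (hT : a % 2 = 0 → T + a = ks + (d - d % 2))
    (hdjl : d + a ≤ jl) :
    (C + (m - a) - (jl - a)) / 2 ≤ (2 * (m - a) + 1 - (g + s0)) / 2 ∧
      (m - a) + ((jl - a - g) / 2 + 1) = (jl - a + s0) / 2 + ((2 * (m - a) + 1 - (g + s0)) / 2 + 1) ∧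
      ks + ((jl - a + s0) / 2 + ((C + (m - a) - (jl - a)) / 2 + 1)) = m + (n + 1) ∧
      ks + ((m - a) + (g + s0 - (g + s0) % 2)) = m + T := by
  have hT' := hT ha2
  subst hgs
  obtain ⟨a2, rfl⟩ : ∃ a2, a = 2 * a2 := ⟨a / 2, by omega⟩
  rcases Nat.even_or_odd' g with ⟨g2, rfl | rfl⟩ <;> rcases Nat.even_or_odd' s0 with ⟨t2, rfl | rfl⟩
  · obtain ⟨m2, rfl⟩ : ∃ m2, m = 2 * m2 := ⟨m / 2, by omega⟩
    obtain ⟨j2, rfl⟩ : ∃ j2, jl = 2 * j2 := ⟨jl / 2, by omega⟩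
    rcases Nat.even_or_odd' b with ⟨b2, rfl | rfl⟩ <;> exact ⟨by omega, by omega, by omega, by omega⟩
  · obtain ⟨m2, rfl⟩ : ∃ m2, m = 2 * m2 + 1 := ⟨m / 2, by omega⟩
    obtain ⟨j2, rfl⟩ : ∃ j2, jl = 2 * j2 := ⟨jl / 2, by omega⟩
    rcases Nat.even_or_odd' b with ⟨b2, rfl | rfl⟩ <;> exact ⟨by omega, by omega, by omega, by omega⟩
  · obtain ⟨m2, rfl⟩ : ∃ m2, m = 2 * m2 + 1 := ⟨m / 2, by omega⟩
    obtain ⟨j2, rfl⟩ : ∃ j2, jl = 2 * j2 + 1 := ⟨jl / 2, by omega⟩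
    rcases Nat.even_or_odd' b with ⟨b2, rfl | rfl⟩ <;> exact ⟨by omega, by omega, by omega, by omega⟩
  · obtain ⟨m2, rfl⟩ : ∃ m2, m = 2 * m2 := ⟨m / 2, by omega⟩
    obtain ⟨j2, rfl⟩ : ∃ j2, jl = 2 * j2 + 1 := ⟨jl / 2, by omega⟩
    rcases Nat.even_or_odd' b with ⟨b2, rfl | rfl⟩ <;> exact ⟨by omega, by omega, by omega, by omega⟩

set_option maxHeartbeats 1600000 in
-- budget only: as above.
/-- **THE LAW'S EXPONENT BOOKKEEPING ON TYPE RamM, FLIPPED LANE (`a` odd)**: ★ `toricCensusSum_ramM_flip_cut`'s shapes `A = (jλ−a+1−g)∕2 + (g+s0)%2`, `B = g + s0 − 1 + (g+s0)%2`.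
[cite: Rogawski1990, §4.9 Prop. 4.9.1 (b) p. 55] -/
theorem exponents_flip_ramM {a b d g s0 ks T m jl n C : ℕ} (hgs : g + s0 = d) (hjlpar : jl % 2 = g % 2) (hmpar : m % 2 = d % 2) (hmjl : m ≤ jl)
    (hab1 : d + 2 * a ≤ b + 1) (hbm : b ≤ m) (hg : 1 ≤ g) (hs0 : 1 ≤ s0) (hC : C = m + jl - b) (hn : (jl - g) / 2 + 1 = n + 1) (ha2 : a % 2 = 1)
    (hks : 2 * ks + 2 * ((d + a % 2) / 2) = a + a % 2 + (b + b % 2)) (hT : a % 2 = 1 → T + a + 1 = ks + (d - d % 2) + 2 * (d % 2))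
    (hdjl : d + a ≤ jl) :
    (C + (m - a) - (jl - a)) / 2 ≤ (2 * (m - a) + 1 - (g + s0)) / 2 ∧
      (m - a) + ((jl - a + 1 - g) / 2 + (g + s0) % 2) = (jl - a + s0) / 2 + ((2 * (m - a) + 1 - (g + s0)) / 2 + 1) ∧
      ks + ((jl - a + s0) / 2 + ((C + (m - a) - (jl - a)) / 2 + 1)) = m + (n + 1) ∧
      ks + ((m - a) + (g + s0 - 1 + (g + s0) % 2)) = m + T := by
  have hT' := hT ha2
  subst hgs
  obtain ⟨a2, rfl⟩ : ∃ a2, a = 2 * a2 + 1 := ⟨a / 2, by omega⟩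
  rcases Nat.even_or_odd' g with ⟨g2, rfl | rfl⟩ <;> rcases Nat.even_or_odd' s0 with ⟨t2, rfl | rfl⟩
  · obtain ⟨m2, rfl⟩ : ∃ m2, m = 2 * m2 := ⟨m / 2, by omega⟩
    obtain ⟨j2, rfl⟩ : ∃ j2, jl = 2 * j2 := ⟨jl / 2, by omega⟩
    rcases Nat.even_or_odd' b with ⟨b2, rfl | rfl⟩ <;> exact ⟨by omega, by omega, by omega, by omega⟩
  · obtain ⟨m2, rfl⟩ : ∃ m2, m = 2 * m2 + 1 := ⟨m / 2, by omega⟩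
    obtain ⟨j2, rfl⟩ : ∃ j2, jl = 2 * j2 := ⟨jl / 2, by omega⟩
    rcases Nat.even_or_odd' b with ⟨b2, rfl | rfl⟩ <;> exact ⟨by omega, by omega, by omega, by omega⟩
  · obtain ⟨m2, rfl⟩ : ∃ m2, m = 2 * m2 + 1 := ⟨m / 2, by omega⟩
    obtain ⟨j2, rfl⟩ : ∃ j2, jl = 2 * j2 + 1 := ⟨jl / 2, by omega⟩
    rcases Nat.even_or_odd' b with ⟨b2, rfl | rfl⟩ <;> exact ⟨by omega, by omega, by omega, by omega⟩
  · obtain ⟨m2, rfl⟩ : ∃ m2, m = 2 * m2 := ⟨m / 2, by omega⟩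
    obtain ⟨j2, rfl⟩ : ∃ j2, jl = 2 * j2 + 1 := ⟨jl / 2, by omega⟩
    rcases Nat.even_or_odd' b with ⟨b2, rfl | rfl⟩ <;> exact ⟨by omega, by omega, by omega, by omega⟩

end Summit.HodgeConjecture.HodgeConjecture.Cruxes.H413.F0P3cDyRamLevelsLawExponentsRamM
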